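import Summits.QuantumFields.YangMills.Theorems.BalabanUVNodesN11DiagonalBranchIntegrable
import Summits.QuantumFields.YangMills.Theorems.BalabanUVNodesN11NoExpansionOldBranchIntegrable
import Summits.QuantumFields.YangMills.Theorems.BalabanUVNodesN11DiagonalOldBranchMeasurable

/-!
# DAG node N11 — ★★★★ THEOREM 1's INDUCTIVE 𝐓-STEP ALONG THE ALL-LARGE-FIELD DIAGONAL AT THE DOOR OF node00-def-K0a's CURED WITNESS WITH NO ANALYTIC BINDER:
# `Provisos₁₃Core` + `SLaw₁₃CoPH … k` + `k < K` + `1 ≤ M` ⇒ the 𝐓-image §2 clause at the all-large new sequence — hmB by `…N11DiagonalOldBranchMeasurable`, hIB by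
# `…N11DiagonalBranchIntegrable`, the re-typed chain by `…N11NoExpansionOldBranchIntegrable`

WHY.  p547792 (g8) proved the diagonal 𝐓-step at the door modulo two displayed analytic binders, the old-branch measurability `hm` and sup bound `hC` (ref-J READ-96:
«NOT EXHIBITED»).  g9 exhibits both: measurability (`…N11DiagonalOldBranchMeasurable.hmB_door_ofCured_of_allLarge`, kernel measurability through 11a's operator algebra)
and — after re-typing the unprovable sup bound to integrability down the whole chain (`…Integrable` files) — integrability (`…N11DiagonalBranchIntegrable`, mass
preservation).  This file is the one-`refine` assembly.

WHAT THIS FILE PROVES (0 `sorry`, 0 `def`).  ★★★★ `exists_clause_succ_CoPH_door_ofCured_of_allLarge_of_core` — at `θ₀ : Stage13Params` with `θ₀.Provisos₁₃Core`, `k < K`,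
`1 ≤ M`, `SLaw₁₃CoPH (ofHistoryBlind (ofCured θ₀)) p k` and an all-large `s` of length `k+1`: `∃ t₀ E′`, the 𝐓-image §2 dichotomy clause of `HasSect2FormAtZ` at `s` for the
door's weights ∕ residual ∕ background.  NO locality ∕ pin ∕ measurability ∕ bound binder remains.  HONEST: one history (the diagonal) at one named family; general
histories need (V)'s A6 inhabitant (`…N11RePinnedParamDefs`) AND a measurability law for `Sect2.TermValues` (absent from the tree); sequences with `Ω_{k+1}(s′) ≠ ∅`
are [III] §3 + Thm 2 proper; `Provisos₁₃Core` (K0) and `SLaw … k` are inputs — N11 is NOT discharged.  Sources: [III] Theorem 1 p. 262, Theorem p. 245, (3.24)–(3.25)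
p. 270, (2.20)–(2.23) p. 258, (3.1) p. 264, (1.11) p. 248; [Balaban1985Averaging] (10) p. 19.
HONEST SCOPE.  Helper lane of K1⁷ `stmt-QuantumFields-20542` (dag-n11-d g9); [folklore] measure theory over the tree's OWN kernels and records; nothing of Bałaban's
estimates is asserted; director-ym №186 (1) respected.  N11 is NOT discharged; counts unmoved (typed 28∕28 · discharged 5∕27).  One finite four-torus programme at
fixed `ε = L^{−K}`; NOT ℝ⁴, NOT OS, NOT a mass gap, NOT Clay.
-/

noncomputable section

open MeasureTheory
open scoped BigOperators Matrix.Norms.L2Operator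

namespace Summit.QuantumFields.YangMills.Theorems.BalabanUVNodesN11DiagonalStepNoBinders

open Literature.MathematicalPhysics.QuantumFieldTheory.Balaban1983to89 T4Continuum T4FiniteEpsInhabited Node00 Node00.Tk DagBinding
open B15DeterminingSets
open BalabanUVNodesN11NoExpansionAllLargeCoP (init_allLarge admSOfRecord_init_eq_of_allLarge)
open BalabanUVNodesN11NoExpansionGeneralStepCoPHDoor (chiSeqOfRecord_init_eq_one_of_allLarge hA_of_allLarge)
open BalabanUVNodesN11DiagonalOldBranchMeasurable (hmB_door_ofCured_of_allLarge)
open BalabanUVNodesN11NoExpansionOldBranchIntegrable (exists_clause_succ_CoPH_of_Omega_empty_of_sLaw₁₃CoPH_of_oldBranch_of_integrable)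
open BalabanUVNodesN11DiagonalBranchIntegrable (integrable_tkBranch_door_of_allLarge)

variable {F : T4Family} {N : ℕ} [NeZero N]

section Door

variable (p : B12.RunParams) (θ₀ : Stage13Params F N)

/-- **★★★★ THEOREM 1's INDUCTIVE 𝐓-STEP AT THE ALL-LARGE-FIELD NEW SEQUENCE OF LENGTH `k+1` AFTER THE ALL-LARGE-FIELD HISTORY, AT THE DOOR OF node00-def-K0a's CURED
WITNESS FAMILY `ofHistoryBlind (ofCured θ₀)`, FROM `θ₀.Provisos₁₃Core` + `SLaw₁₃CoPH … k` + `k < K` + `1 ≤ M` ALONE** — no locality, pin, measurability or bound binder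
is left: (Q)∕(P)∕`hA`∕(V)∕`hq` are discharged as in `…GeneralStepCoPHDoor`, the old-branch measurability `hmB` by `…N11DiagonalOldBranchMeasurable`, and the
old-branch integrability `hIB` (this file's re-typing of the former sup bound `hCB`) by §2's mass preservation.  Conclusion: the 𝐓-image §2 dichotomy clause of
`HasSect2FormAtZ` holds at `s′` for SLaw's term values at `init s′` and some vacuum constant — the `s′`-summand of `TLaw₁₃CoPH θ p k` on the diagonal.  HONEST: one
history (the diagonal), at one named parameter family; the general history needs the A6 inhabitant of (V) (`…RePinnedParamDefs`) and a measurability law for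
`Sect2.TermValues` (not in the tree); N11 is NOT discharged. [cite: Balaban1988Convergent, Theorem 1 p.262, Theorem p.245, (3.24)–(3.25) p.270, (2.20)–(2.23) p.258,
(3.1) p.264, (1.11) p.248; Balaban1985Averaging, (10) p.19] -/
theorem exists_clause_succ_CoPH_door_ofCured_of_allLarge_of_core (h : θ₀.Provisos₁₃Core F N) {k : ℕ} (hk : k < p.K) (hM : 1 ≤ θ₀.τ9.M)
    (hS : SLaw₁₃CoPH F N (Stage13HParams.ofHistoryBlind F N (Stage13RParams.ofCured F N θ₀)) p k)
    (s : SeqOfRecord F θ₀.ν θ₀.τ9.M (gOfRecord₁₃ F N θ₀ p) p.K (k + 1)) (hall : ∀ j, 1 ≤ j → j ≤ k + 1 → s.Ω j = ∅) :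
    ∃ (t₀ : Sect2.TermValues (F.P p.K) (MatA N) (FluctV N) θ₀.τ9.M) (E' : ℝ),
      slotsTOfRecord F N θ₀.ν θ₀.τ9 (EOfRecord₁₃ F N θ₀) (wOfRecord₉ F N θ₀.toStage9Params) θ₀.ppSel p (gOfRecord₁₃ F N θ₀ p) (k + 1) s = 0 ∨
        ∀ᵐ V' ∂fieldMeasure (F.P p.K) (k + 1) (SU N),
          chiSeqOfRecord F N θ₀.ν θ₀.τ9.M (gOfRecord₁₃ F N θ₀ p) p.K (k + 1) s V' ≠ 0 →
            slotsTOfRecord F N θ₀.ν θ₀.τ9 (EOfRecord₁₃ F N θ₀) (wOfRecord₉ F N θ₀.toStage9Params) θ₀.ppSel p (gOfRecord₁₃ F N θ₀ p) (k + 1) s V' =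
              sect2Slot F N (FluctV N) p.K (settingOfRecord₁₃ F N θ₀ p)
                ((Stage13HParams.ofHistoryBlind F N (Stage13RParams.ofCured F N θ₀)).rzAt p s)
                (WtOfRecord₁₃H F N (Stage13HParams.ofHistoryBlind F N (Stage13RParams.ofCured F N θ₀)) p s) s t₀ E'
                (UbgOfRecord₁₃CoP F N θ₀ p (k + 1) s) V' := by
  obtain rfl : s = seqAllLargeOfRecord F θ₀.ν θ₀.τ9.M (gOfRecord₁₃ F N θ₀ p) p.K (k + 1) :=
    BalabanUVNodesN11ResidualPinCompletion.seq_eq_seqAllLargeOfRecord θ₀.ν θ₀.τ9.M _ p.K (k + 1) s hall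
  have hinit : (seqAllLargeOfRecord F θ₀.ν θ₀.τ9.M (gOfRecord₁₃ F N θ₀ p) p.K (k + 1)).init =
      seqAllLargeOfRecord F θ₀.ν θ₀.τ9.M (gOfRecord₁₃ F N θ₀ p) p.K k :=
    BalabanUVNodesN11ResidualPinCompletion.seq_eq_seqAllLargeOfRecord θ₀.ν θ₀.τ9.M _ p.K k _ (init_allLarge θ₀ p _ hall)
  refine exists_clause_succ_CoPH_of_Omega_empty_of_sLaw₁₃CoPH_of_oldBranch_of_integrable
    (Stage13HParams.ofHistoryBlind F N (Stage13RParams.ofCured F N θ₀)) p h.ofCured.ofHistoryBlind hk hM hS _ rfl (fun j _ ω ω' _ => ?_)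
    (fun _ _ => ⟨rfl, rfl⟩) (fun t₀ E₀ => hA_of_allLarge θ₀ p hM _ hall _ _ t₀ E₀) (fun V' U₀ => ?_) (fun V' U₀ => ?_)
    (fun t₀ E₀ => hmB_door_ofCured_of_allLarge p θ₀ h hM _ hall t₀ E₀) (fun t₀ E₀ S hSm => ?_)
  · show (ZrOfRecord₁₃ F N θ₀ p).quad j _ ω = (ZrOfRecord₁₃ F N θ₀ p).quad j _ ω'
    rw [ZrOfRecord₁₃_quad, ZrOfRecord₁₃_quad]
  · show (ZrOfRecord₁₃ F N θ₀ p).ζ0 k Set.univ (pairCfgAt (V := FluctV N) k V' U₀) =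
      chiSeqOfRecord F N θ₀.ν θ₀.τ9.M (gOfRecord₁₃ F N θ₀ p) p.K k (seqAllLargeOfRecord F θ₀.ν θ₀.τ9.M (gOfRecord₁₃ F N θ₀ p) p.K (k + 1)).init U₀ *
        wOfRecord₉ F N θ₀.toStage9Params p (gOfRecord₁₃ F N θ₀ p) k (seqAllLargeOfRecord F θ₀.ν θ₀.τ9.M (gOfRecord₁₃ F N θ₀ p) p.K (k + 1)) U₀
          ((avOfRecord F N p.K k).avg U₀)
    rw [chiSeqOfRecord_init_eq_one_of_allLarge θ₀ p _ hall U₀, one_mul]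
    exact ZrOfRecord₁₃_ζ0_univ_pairCfgAt hk V' U₀
  · show (ZrOfRecord₁₃ F N θ₀ p).quad k ∅ (pairCfgAt (V := FluctV N) k V' U₀) = 0
    rw [ZrOfRecord₁₃_quad]
  · -- ★ the old branch is integrable on the diagonal (§2): the old index is the all-empty branch, the history is all-large, the weights are the cured ones
    have hS0 : S = fun _ => ∅ := by
      have this : S ∈ admSOfRecord F θ₀.ν θ₀.τ9.M (gOfRecord₁₃ F N θ₀ p) p.K k
          (seqAllLargeOfRecord F θ₀.ν θ₀.τ9.M (gOfRecord₁₃ F N θ₀ p) p.K (k + 1)).init := hSm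
      rw [admSOfRecord_init_eq_of_allLarge θ₀ p _ hall, Finset.mem_singleton] at this
      exact this
    subst hS0
    have hI := integrable_tkBranch_door_of_allLarge θ₀ p h hM (le_of_lt hk)
      ((Stage13HParams.ofHistoryBlind F N (Stage13RParams.ofCured F N θ₀)).rzAt p
        (seqAllLargeOfRecord F θ₀.ν θ₀.τ9.M (gOfRecord₁₃ F N θ₀ p) p.K (k + 1)).init) t₀ E₀ k le_rfl
    rw [← hinit] at hI
    exact hI

end Door


end Summit.QuantumFields.YangMills.Theorems.BalabanUVNodesN11DiagonalStepNoBinders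

end
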